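import Summits.QuantumFields.QCD.Theses.NestedDissectionSea
import Summits.QuantumFields.QCD.Theorems.NegativeCellsDilute.Negative.CellPositivity

/-!
# Stub `stub_sojourn` of line `mass-wegner-cell-index`
(crux `Summit.QuantumFields.QCD.Theses.NestedDissectionSea.NegativeCellsDilute`, item stmt-QuantumFields-13900)

**The bare mass is a scalar shift of every Dirichlet cell matrix.**  For an `SU(3)` lattice gauge
field `U` on the four-torus `(ℤ/N)⁴`, the `r = 1` Wilson–Dirac matrix is
`D_W(U, m, 1) = (m + 4)·1 − Σ_μ W_μ` (tree: `wilsonDirac_eq_sub_sum_wilsonHop`, the hopping part does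
not depend on the bare mass), hence `D_W(U, μ', 1) = D_W(U, μ₀, 1) + (μ' − μ₀)·1`.  Restriction to the
principal block on an open box `(x, s)` (`wilsonCell U μ x s = toSquareBlockProp (D_W(U, μ, 1)) (box)`)
commutes with sums and with scalar multiples of the identity, so
`wilsonCell U μ' x s = wilsonCell U μ₀ x s + (μ' − μ₀)·1`; consequently a kernel vector `v` of the cell
at bare mass `μ₀` is an exact eigenvector with eigenvalue `μ' − μ₀` at every bare mass `μ'`:
`wilsonCell U μ' x s *ᵥ v = (μ' − μ₀) • v`.
Uses only the tree identity above and the landed block lemmas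
`NegativeCellsDiluteCellPositivity.fund_unitary / toSquareBlockProp_smul / toSquareBlockProp_one`.
-/

noncomputable section

namespace Summit.QuantumFields.QCD.Cruxes.NegativeCellsDilute.MassWegnerCellIndex

open scoped BigOperators ENNReal Classical
open MeasureTheory Filter
open Literature.MathematicalPhysics.QuantumLattice Literature.MathematicalPhysics.QuantumFieldTheory
  Literature.Probability.LatticeModels
open Summit.QuantumFields.QCD.Theorems.NegativeCellsDiluteCellPositivity (fund_unitary
  toSquareBlockProp_smul toSquareBlockProp_one)

/-- The bare mass enters the Wilson–Dirac matrix as a scalar shift: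
`D_W(U, μ', 1) = D_W(U, μ₀, 1) + (μ' − μ₀)·1`. -/
private theorem sojourn_wilsonDirac_shift {N : ℕ}
    (U : GaugeConfig 4 N (Matrix.specialUnitaryGroup (Fin 3) ℂ)) (μ₀ μ' : ℝ) :
    wilsonDirac (fundamentalRep (Fin 3)) U μ' 1 =
      wilsonDirac (fundamentalRep (Fin 3)) U μ₀ 1 +
        ((μ' - μ₀ : ℝ) : ℂ) • (1 : Matrix _ _ ℂ) := by
  rw [wilsonDirac_eq_sub_sum_wilsonHop _ fund_unitary U μ',
    wilsonDirac_eq_sub_sum_wilsonHop _ fund_unitary U μ₀,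
    Complex.ofReal_sub, Complex.ofReal_add, Complex.ofReal_add, sub_smul, add_smul, add_smul]
  abel

/-- The bare mass enters every Dirichlet cell matrix as a scalar shift:
`wilsonCell U μ' x s = wilsonCell U μ₀ x s + (μ' − μ₀)·1`. -/
private theorem sojourn_wilsonCell_shift {N : ℕ} [NeZero N]
    (U : GaugeConfig 4 N (Matrix.specialUnitaryGroup (Fin 3) ℂ)) (μ₀ μ' : ℝ)
    (x : TorusSite 4 N) (s : Fin 4 → ℕ) :
    wilsonCell U μ' x s = wilsonCell U μ₀ x s + ((μ' - μ₀ : ℝ) : ℂ) • 1 := by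
  unfold wilsonCell
  rw [sojourn_wilsonDirac_shift U μ₀ μ', ← toSquareBlockProp_one (wilsonBox x s),
    ← toSquareBlockProp_smul]
  rfl

/-- **Stub 1c — `sojourn`.** If `v` is a kernel vector of the Dirichlet cell `(x, s)` at bare mass
`μ₀`, then at every bare mass `μ'` it is an exact eigenvector with eigenvalue `μ' − μ₀`:
`wilsonCell U μ' x s *ᵥ v = (μ' − μ₀) • v`. -/
theorem stub_sojourn :
    ∀ (N : ℕ) [NeZero N] (U : GaugeConfig 4 N (Matrix.specialUnitaryGroup (Fin 3) ℂ)) (μ₀ μ' : ℝ)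
      (x : TorusSite 4 N) (s : Fin 4 → ℕ) (v : {p // wilsonBox x s p} → ℂ),
      (wilsonCell U μ₀ x s).mulVec v = 0 →
      (wilsonCell U μ' x s).mulVec v = ((μ' - μ₀ : ℝ) : ℂ) • v := by
  intro N _ U μ₀ μ' x s v hv
  rw [sojourn_wilsonCell_shift U μ₀ μ' x s, Matrix.add_mulVec, hv, zero_add,
    Matrix.smul_mulVec, Matrix.one_mulVec]

end Summit.QuantumFields.QCD.Cruxes.NegativeCellsDilute.MassWegnerCellIndex

end
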